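import Mathlib.Analysis.InnerProductSpace.PiL2
import Mathlib.Analysis.InnerProductSpace.Projection.FiniteDimensional
import HarnessLib

/-!
# Two balls at distance `≥ √2` have at most four common contacts in a packing

HONEST FRAMING. Venture `Summits/Ventures/Crystal3D` (cell `crystal3d-full`), helper `--supports` the crux `CoaxialWallLaw`
(stmt-Ventures-19481) of `route-Ventures-StickyWulffConstant`, lane F 'Certificates' T5b (multi-piece split of the seam side; memo
STARSHARE-g19.md on the item, fact (P2)).  Companion of '…CoaxialWallLawStarSharing' (shared STAR balls ≤ 2): here the bound on ALL
common contacts.  Two EXACT 13-clusters with non-adjacent centres have centres `≥ √2` apart (second-shell gap), so they share at most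
four dozen balls — the shared-square configuration of the memo shows `4` is attained.

* `quadrant_spec`, `inner_pos_of_quadrant_eq` — half-open quadrants of a coordinate pair (pigeonhole tool);
* `card_le_four_of_perp_of_inner_nonpos` — in `E³`, nonzero vectors orthogonal to a fixed nonzero `u` with pairwise non-positive inner
  products number at most four (orthonormal frame `(û, e₁, e₂)`, half-open quadrants of the `(e₁, e₂)`-coordinates, pigeonhole);
* `card_common_contacts_le_four` — `√2 ≤ dist q₁ q₂`, `T` a set of points pairwise `≥ 1` apart, each at distance `1` from `q₁` and from
  `q₂` ⇒ `#T ≤ 4` (the points, re-centred at the midpoint, are orthogonal to `q₂ − q₁`, have norm² `= 1 − d²/4 ≤ ½`, hence pairwise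
  inner products `≤ 0`);
* `card_filter_common_contacts_le_four` — configuration form for a `1`-separated `X`.

WHAT THIS IS NOT: not an overlap lemma for pieces (memo §4/§6: false in general); F-C1 not moved; the 3D crystallization summit is not claimed.
-/

noncomputable section

namespace Summit.Ventures.Crystal3D.Theorems

namespace StarSharing

open Module Finset
open scoped InnerProductSpace

/-- A unit vector orthogonal to two given nonzero vectors of `E³` exists (dimension count). -/
theorem exists_unit_normal {a b : EuclideanSpace ℝ (Fin 3)} (ha0 : a ≠ 0) (hb0 : b ≠ 0) :
    ∃ w : EuclideanSpace ℝ (Fin 3), ‖w‖ = 1 ∧ ⟪w, a⟫_ℝ = 0 ∧ ⟪w, b⟫_ℝ = 0 := by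
  set K : Submodule ℝ (EuclideanSpace ℝ (Fin 3)) := (ℝ ∙ a) ⊔ (ℝ ∙ b) with hK
  have hK2 : finrank ℝ K ≤ 2 := by
    have h := Submodule.finrank_add_le_finrank_add_finrank (ℝ ∙ a) (ℝ ∙ b)
    rw [finrank_span_singleton ha0, finrank_span_singleton hb0] at h
    exact h
  have hE : finrank ℝ (EuclideanSpace ℝ (Fin 3)) = 3 := by simp
  have hsum := Submodule.finrank_add_finrank_orthogonal K
  have hKo : Kᗮ ≠ ⊥ := by
    intro h
    have h0 : finrank ℝ Kᗮ = 0 := by rw [h]; simp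
    omega
  obtain ⟨w, hw, hw0⟩ := Submodule.exists_mem_ne_zero_of_ne_bot hKo
  have hwa : ⟪w, a⟫_ℝ = 0 := by
    rw [real_inner_comm]
    exact Submodule.inner_right_of_mem_orthogonal (Submodule.mem_sup_left (Submodule.mem_span_singleton_self a)) hw
  have hwb : ⟪w, b⟫_ℝ = 0 := by
    rw [real_inner_comm]
    exact Submodule.inner_right_of_mem_orthogonal (Submodule.mem_sup_right (Submodule.mem_span_singleton_self b)) hw
  have hnw : ‖w‖ ≠ 0 := norm_ne_zero_iff.2 hw0
  refine ⟨‖w‖⁻¹ • w, ?_, ?_, ?_⟩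
  · rw [norm_smul, norm_inv, norm_norm, inv_mul_cancel₀ hnw]
  · rw [real_inner_smul_left, hwa, mul_zero]
  · rw [real_inner_smul_left, hwb, mul_zero]

/-- What the half-open QUADRANT index `(if 0 < a ∧ 0 ≤ c then 0 else if a ≤ 0 ∧ 0 < c then 1 else if a < 0 ∧ c ≤ 0 then 2 else 3) : Fin 4`
of a nonzero coordinate pair says about the signs. -/
theorem quadrant_spec {a c : ℝ} (h0 : a ≠ 0 ∨ c ≠ 0) :
    ((if 0 < a ∧ 0 ≤ c then (0 : Fin 4) else if a ≤ 0 ∧ 0 < c then 1 else if a < 0 ∧ c ≤ 0 then 2 else 3) = 0 → 0 < a ∧ 0 ≤ c) ∧ ((if 0 < a ∧ 0 ≤ c then (0 : Fin 4) else if a ≤ 0 ∧ 0 < c then 1 else if a < 0 ∧ c ≤ 0 then 2 else 3) = 1 → a ≤ 0 ∧ 0 < c) ∧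
      ((if 0 < a ∧ 0 ≤ c then (0 : Fin 4) else if a ≤ 0 ∧ 0 < c then 1 else if a < 0 ∧ c ≤ 0 then 2 else 3) = 2 → a < 0 ∧ c ≤ 0) ∧ ((if 0 < a ∧ 0 ≤ c then (0 : Fin 4) else if a ≤ 0 ∧ 0 < c then 1 else if a < 0 ∧ c ≤ 0 then 2 else 3) = 3 → 0 ≤ a ∧ c < 0) := by
  by_cases h1 : 0 < a ∧ 0 ≤ c
  · rw [if_pos h1]; exact ⟨fun _ => h1, fun h => absurd h (by decide), fun h => absurd h (by decide), fun h => absurd h (by decide)⟩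
  rw [if_neg h1]
  by_cases h2 : a ≤ 0 ∧ 0 < c
  · rw [if_pos h2]; exact ⟨fun h => absurd h (by decide), fun _ => h2, fun h => absurd h (by decide), fun h => absurd h (by decide)⟩
  rw [if_neg h2]
  by_cases h3 : a < 0 ∧ c ≤ 0
  · rw [if_pos h3]; exact ⟨fun h => absurd h (by decide), fun h => absurd h (by decide), fun _ => h3, fun h => absurd h (by decide)⟩
  rw [if_neg h3]
  refine ⟨fun h => absurd h (by decide), fun h => absurd h (by decide), fun h => absurd h (by decide), fun _ => ?_⟩
  rw [not_and_or, not_lt, not_le] at h1 h2 h3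
  have hc : c ≤ 0 := by
    rcases h2 with ha | hc
    · rcases h1 with ha' | hc'
      · exact absurd ha' (not_le.2 ha)
      · exact hc'.le
    · exact hc
  have ha : 0 ≤ a := by
    rcases h3 with ha | hc'
    · exact ha
    · exact absurd hc' (not_lt.2 hc)
  refine ⟨ha, lt_of_le_of_ne hc fun hc0 => ?_⟩
  rcases h0 with ha0 | hc0'
  · rcases h1 with ha' | hc'
    · exact ha0 (le_antisymm ha' ha)
    · rw [hc0] at hc'; exact lt_irrefl _ hc'
  · exact hc0' hc0

/-- Two nonzero coordinate pairs in the same half-open quadrant have positive inner product. -/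
theorem inner_pos_of_quadrant_eq {a c a' c' : ℝ} (h0 : a ≠ 0 ∨ c ≠ 0) (h0' : a' ≠ 0 ∨ c' ≠ 0)
    (hq : (if 0 < a ∧ 0 ≤ c then (0 : Fin 4) else if a ≤ 0 ∧ 0 < c then 1 else if a < 0 ∧ c ≤ 0 then 2 else 3) =
      (if 0 < a' ∧ 0 ≤ c' then (0 : Fin 4) else if a' ≤ 0 ∧ 0 < c' then 1 else if a' < 0 ∧ c' ≤ 0 then 2 else 3)) : 0 < a * a' + c * c' := by
  obtain ⟨s0, s1, s2, s3⟩ := quadrant_spec h0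
  obtain ⟨t0, t1, t2, t3⟩ := quadrant_spec h0'
  have hk : (if 0 < a' ∧ 0 ≤ c' then (0 : Fin 4) else if a' ≤ 0 ∧ 0 < c' then 1 else if a' < 0 ∧ c' ≤ 0 then 2 else 3) = 0 ∨ (if 0 < a' ∧ 0 ≤ c' then (0 : Fin 4) else if a' ≤ 0 ∧ 0 < c' then 1 else if a' < 0 ∧ c' ≤ 0 then 2 else 3) = 1 ∨
      (if 0 < a' ∧ 0 ≤ c' then (0 : Fin 4) else if a' ≤ 0 ∧ 0 < c' then 1 else if a' < 0 ∧ c' ≤ 0 then 2 else 3) = 2 ∨ (if 0 < a' ∧ 0 ≤ c' then (0 : Fin 4) else if a' ≤ 0 ∧ 0 < c' then 1 else if a' < 0 ∧ c' ≤ 0 then 2 else 3) = 3 := by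
    generalize (if 0 < a' ∧ 0 ≤ c' then (0 : Fin 4) else if a' ≤ 0 ∧ 0 < c' then 1 else if a' < 0 ∧ c' ≤ 0 then 2 else 3) = k; fin_cases k <;> simp
  rcases hk with hk | hk | hk | hk
  · obtain ⟨x1, x2⟩ := s0 (hq.trans hk); obtain ⟨y1, y2⟩ := t0 hk
    nlinarith [mul_pos x1 y1, mul_nonneg x2 y2]
  · obtain ⟨x1, x2⟩ := s1 (hq.trans hk); obtain ⟨y1, y2⟩ := t1 hk
    nlinarith [mul_pos x2 y2, mul_nonneg_of_nonpos_of_nonpos x1 y1]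
  · obtain ⟨x1, x2⟩ := s2 (hq.trans hk); obtain ⟨y1, y2⟩ := t2 hk
    nlinarith [mul_pos_of_neg_of_neg x1 y1, mul_nonneg_of_nonpos_of_nonpos x2 y2]
  · obtain ⟨x1, x2⟩ := s3 (hq.trans hk); obtain ⟨y1, y2⟩ := t3 hk
    nlinarith [mul_pos_of_neg_of_neg x2 y2, mul_nonneg x1 y1]

/-- **At most four pairwise non-acute nonzero vectors orthogonal to a line in `E³`.** -/
theorem card_le_four_of_perp_of_inner_nonpos {u : EuclideanSpace ℝ (Fin 3)} (hu : u ≠ 0) (W : Finset (EuclideanSpace ℝ (Fin 3)))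
    (h0 : ∀ w ∈ W, w ≠ 0) (hperp : ∀ w ∈ W, ⟪w, u⟫_ℝ = 0) (hob : ∀ w ∈ W, ∀ w' ∈ W, w ≠ w' → ⟪w, w'⟫_ℝ ≤ 0) :
    W.card ≤ 4 := by
  classical
  by_contra hlt
  push Not at hlt
  obtain ⟨w₁, hw₁⟩ : W.Nonempty := Finset.card_pos.1 (by omega)
  have hw₁0 : w₁ ≠ 0 := h0 w₁ hw₁
  -- orthonormal frame `(û, e₁, e₂)` with `e₁ ∥ w₁`
  obtain ⟨e₂, he₂1, he₂u, he₂w⟩ := exists_unit_normal hu hw₁0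
  set û : EuclideanSpace ℝ (Fin 3) := ‖u‖⁻¹ • u with hû
  set e₁ : EuclideanSpace ℝ (Fin 3) := ‖w₁‖⁻¹ • w₁ with he₁
  have hnu : ‖u‖ ≠ 0 := norm_ne_zero_iff.2 hu
  have hnw : ‖w₁‖ ≠ 0 := norm_ne_zero_iff.2 hw₁0
  have hû1 : ‖û‖ = 1 := by rw [hû, norm_smul, norm_inv, norm_norm, inv_mul_cancel₀ hnu]
  have he₁1 : ‖e₁‖ = 1 := by rw [he₁, norm_smul, norm_inv, norm_norm, inv_mul_cancel₀ hnw]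
  have hûe₁ : ⟪û, e₁⟫_ℝ = 0 := by
    rw [hû, he₁, real_inner_smul_left, real_inner_smul_right, real_inner_comm, hperp w₁ hw₁]; ring
  have hûe₂ : ⟪û, e₂⟫_ℝ = 0 := by rw [hû, real_inner_smul_left, real_inner_comm, he₂u]; ring
  have he₁e₂ : ⟪e₁, e₂⟫_ℝ = 0 := by rw [he₁, real_inner_smul_left, real_inner_comm, he₂w]; ring
  set v : Fin 3 → EuclideanSpace ℝ (Fin 3) := ![û, e₁, e₂] with hv
  have hon : Orthonormal ℝ v := by
    rw [orthonormal_iff_ite]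
    intro i j
    fin_cases i <;> fin_cases j <;>
      simp [hv, hû1, he₁1, he₂1, hûe₁, hûe₂, he₁e₂, real_inner_comm û e₁, real_inner_comm û e₂,
        real_inner_comm e₁ e₂]
  have hcard : Fintype.card (Fin 3) = finrank ℝ (EuclideanSpace ℝ (Fin 3)) := by simp
  have htop : Submodule.span ℝ (Set.range v) = ⊤ := hon.linearIndependent.span_eq_top_of_card_eq_finrank hcard
  let b : OrthonormalBasis (Fin 3) ℝ (EuclideanSpace ℝ (Fin 3)) := OrthonormalBasis.mk hon htop.ge
  have hb : ∀ i, b i = v i := fun i => by rw [OrthonormalBasis.coe_mk]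
  -- coordinates and the inner-product formula for vectors orthogonal to `u`
  have hwû : ∀ w ∈ W, ⟪w, û⟫_ℝ = 0 := fun w hw => by rw [hû, real_inner_smul_right, hperp w hw, mul_zero]
  have formula : ∀ w ∈ W, ∀ w' ∈ W, ⟪w, w'⟫_ℝ = ⟪w, e₁⟫_ℝ * ⟪w', e₁⟫_ℝ + ⟪w, e₂⟫_ℝ * ⟪w', e₂⟫_ℝ := by
    intro w hw w' hw'
    have h := b.sum_inner_mul_inner w w'
    rw [Fin.sum_univ_three, hb, hb, hb] at h
    simp only [hv, Matrix.cons_val_zero, Matrix.cons_val_one, Matrix.cons_val] at h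
    rw [← h, hwû w hw, real_inner_comm (w' : EuclideanSpace ℝ (Fin 3)) e₁, real_inner_comm (w' : EuclideanSpace ℝ (Fin 3)) e₂]
    ring
  have nonzero : ∀ w ∈ W, ⟪w, e₁⟫_ℝ ≠ 0 ∨ ⟪w, e₂⟫_ℝ ≠ 0 := by
    intro w hw
    by_contra h
    push Not at h
    have hself := formula w hw w hw
    rw [h.1, h.2, real_inner_self_eq_norm_sq] at hself
    have : ‖w‖ = 0 := by nlinarith [norm_nonneg w]
    exact h0 w hw (norm_eq_zero.1 this)
  -- pigeonhole on the four half-open quadrants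
  have hmaps : Set.MapsTo (fun w : EuclideanSpace ℝ (Fin 3) => (if 0 < ⟪w, e₁⟫_ℝ ∧ 0 ≤ ⟪w, e₂⟫_ℝ then (0 : Fin 4) else if ⟪w, e₁⟫_ℝ ≤ 0 ∧ 0 < ⟪w, e₂⟫_ℝ then 1 else if ⟪w, e₁⟫_ℝ < 0 ∧ ⟪w, e₂⟫_ℝ ≤ 0 then 2 else 3))
      W (Finset.univ : Finset (Fin 4)) := fun w _ => Finset.mem_univ _
  have hc : (Finset.univ : Finset (Fin 4)).card < W.card := by simp; omega
  obtain ⟨w, hw, w', hw', hne, hq⟩ := Finset.exists_ne_map_eq_of_card_lt_of_maps_to hc hmaps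
  have hpos := inner_pos_of_quadrant_eq (nonzero w hw) (nonzero w' hw') hq
  have hle := hob w hw w' hw' hne
  rw [formula w hw w' hw'] at hle
  linarith

/-- **Two balls at distance `≥ √2` have at most FOUR common contacts pairwise `≥ 1` apart.** -/
theorem card_common_contacts_le_four {q₁ q₂ : EuclideanSpace ℝ (Fin 3)} (hd : Real.sqrt 2 ≤ dist q₁ q₂)
    (T : Finset (EuclideanSpace ℝ (Fin 3))) (hT : ∀ p ∈ T, dist p q₁ = 1 ∧ dist p q₂ = 1)
    (hsep : ∀ p ∈ T, ∀ p' ∈ T, p ≠ p' → 1 ≤ dist p p') : T.card ≤ 4 := by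
  classical
  set u : EuclideanSpace ℝ (Fin 3) := q₂ - q₁ with hu
  set m : EuclideanSpace ℝ (Fin 3) := q₁ + (1 / 2 : ℝ) • u with hm
  have hd' : Real.sqrt 2 ≤ ‖u‖ := by rwa [hu, ← dist_eq_norm, dist_comm]
  have hs2 : Real.sqrt 2 ^ 2 = 2 := Real.sq_sqrt (by norm_num)
  have hu2 : 2 ≤ ‖u‖ ^ 2 := by nlinarith [Real.sqrt_nonneg 2]
  have hu0 : u ≠ 0 := by
    intro h; rw [h, norm_zero] at hd'; exact absurd hd' (by rw [not_le]; positivity)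
  -- re-centred vectors
  have key : ∀ p ∈ T, ⟪p - m, u⟫_ℝ = 0 ∧ ‖p - m‖ ^ 2 = 1 - ‖u‖ ^ 2 / 4 := by
    intro p hp
    obtain ⟨h1, h2⟩ := hT p hp
    have ha : ‖p - q₁‖ = 1 := by rwa [← dist_eq_norm]
    have hb : ‖p - q₁ - u‖ = 1 := by rw [hu, show p - q₁ - (q₂ - q₁) = p - q₂ by abel, ← dist_eq_norm]; exact h2
    have hb2 : ‖p - q₁ - u‖ ^ 2 = ‖p - q₁‖ ^ 2 - 2 * ⟪p - q₁, u⟫_ℝ + ‖u‖ ^ 2 := norm_sub_sq_real _ _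
    rw [ha, hb] at hb2
    have hin : ⟪p - q₁, u⟫_ℝ = ‖u‖ ^ 2 / 2 := by linarith
    have hpm : p - m = (p - q₁) - (1 / 2 : ℝ) • u := by rw [hm]; abel
    refine ⟨?_, ?_⟩
    · rw [hpm, inner_sub_left, real_inner_smul_left, hin, real_inner_self_eq_norm_sq]; ring
    · rw [hpm, norm_sub_sq_real, ha, real_inner_smul_right, hin, norm_smul, Real.norm_eq_abs, abs_of_pos (by norm_num : (0:ℝ) < 1 / 2)]
      ring
  by_cases hdeg : ‖u‖ ^ 2 = 4
  · -- antipodal centres: every common contact is the midpoint, so `#T ≤ 1`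
    have hsub : ∀ p ∈ T, p = m := by
      intro p hp
      have h := (key p hp).2
      rw [hdeg] at h
      have : ‖p - m‖ = 0 := by nlinarith [norm_nonneg (p - m)]
      exact sub_eq_zero.1 (norm_eq_zero.1 this)
    have : T.card ≤ 1 := Finset.card_le_one.2 fun p hp p' hp' => by rw [hsub p hp, hsub p' hp']
    omega
  · set W := T.image fun p => p - m with hW
    have hinj : Set.InjOn (fun p : EuclideanSpace ℝ (Fin 3) => p - m) ↑T := fun p _ p' _ h => sub_left_injective h
    have hcardW : W.card = T.card := Finset.card_image_of_injOn hinj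
    rw [← hcardW]
    refine card_le_four_of_perp_of_inner_nonpos hu0 W ?_ ?_ ?_
    · intro w hw
      obtain ⟨p, hp, rfl⟩ := Finset.mem_image.1 hw
      intro h0
      have h := (key p hp).2
      rw [h0, norm_zero] at h
      -- `‖u‖² = 4` would follow, contradiction; else `‖u‖ ≤ 2` from the triangle inequality
      have hle : ‖u‖ ≤ 2 := by
        obtain ⟨h1, h2⟩ := hT p hp
        have : dist q₁ q₂ ≤ dist q₁ p + dist p q₂ := dist_triangle _ _ _
        rw [dist_comm q₁ p, h1, h2] at this
        rw [hu, ← dist_eq_norm, dist_comm]; linarith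
      apply hdeg; nlinarith [norm_nonneg u]
    · intro w hw
      obtain ⟨p, hp, rfl⟩ := Finset.mem_image.1 hw
      exact (key p hp).1
    · intro w hw w' hw' hne
      obtain ⟨p, hp, rfl⟩ := Finset.mem_image.1 hw
      obtain ⟨p', hp', rfl⟩ := Finset.mem_image.1 hw'
      have hpp : p ≠ p' := fun h => hne (by rw [h])
      have hdist : 1 ≤ ‖(p - m) - (p' - m)‖ := by
        rw [show (p - m) - (p' - m) = p - p' by abel, ← dist_eq_norm]; exact hsep p hp p' hp' hpp
      have hsq : ‖(p - m) - (p' - m)‖ ^ 2 = ‖p - m‖ ^ 2 - 2 * ⟪p - m, p' - m⟫_ℝ + ‖p' - m‖ ^ 2 := norm_sub_sq_real _ _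
      rw [(key p hp).2, (key p' hp').2] at hsq
      nlinarith

open scoped Classical in
/-- **Configuration form.**  In a `1`-separated configuration `X`, two points at distance `≥ √2` have at most four common contacts.  Two exact
13-clusters with non-adjacent centres (hence `≥ √2` apart, second-shell gap) share at most four dozen balls. -/
theorem card_filter_common_contacts_le_four (X : Finset (EuclideanSpace ℝ (Fin 3))) (hX : ∀ p ∈ X, ∀ q ∈ X, p ≠ q → 1 ≤ dist p q)
    {q₁ q₂ : EuclideanSpace ℝ (Fin 3)} (hd : Real.sqrt 2 ≤ dist q₁ q₂) :
    (X.filter fun p => dist q₁ p = 1 ∧ dist q₂ p = 1).card ≤ 4 := by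
  refine card_common_contacts_le_four hd _ (fun p hp => ?_) (fun p hp p' hp' hne => ?_)
  · obtain ⟨-, h1, h2⟩ := Finset.mem_filter.1 hp
    exact ⟨by rwa [dist_comm], by rwa [dist_comm]⟩
  · exact hX p (Finset.mem_filter.1 hp).1 p' (Finset.mem_filter.1 hp').1 hne

end StarSharing

end Summit.Ventures.Crystal3D.Theorems

end
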